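import Mathlib.Algebra.GroupWithZero.NonZeroDivisors
import Mathlib.RingTheory.Ideal.Quotient.Operations
import Mathlib.RingTheory.Nakayama
import Mathlib.RingTheory.Noetherian.Basic
import Mathlib.SetTheory.Cardinal.Finite
import HarnessLib

/-!
# The Berger–Klosin commutative-algebra `R = T` criterion (stub `stub_bergerKlosinCriterion`) —
# line `sector-klingen-split`, crux `ResiduallyYoshidaLifting` (stmt-Langlands-13639)

Stub-worker of lead prover-line-stmt-Langlands-13639-c5-0 (2026-08-17), skeleton rev 13, sub-goal BK: the
commutative-algebra engine of the Berger–Klosin `R = T` method at a residually reducible (Yoshida-type) maximal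
ideal, where no Taylor–Wiles primes are available.  In the application `R` is the universal deformation ring, `x` a
generator of its (principal) reducibility ideal, `S = T` the Hecke algebra and `#S/(φ x)` a congruence-module lower
bound.

**Statement.**  Let `φ : R ↠ S` be a surjection of commutative rings with `R` Noetherian, and let `x ∈ R` lie in
the Jacobson radical with `φ x` a non-zero-divisor of `S`.  If `R/(x)` is finite and `#R/(x) ≤ #S/(φ x)` then `φ`
is bijective.

**Proof.**  Put `I = (x)` and `K = ker φ`.
1. `φ` induces a surjection `R/I ↠ S/(φ x)` (`Ideal.quotientMap`); a surjection out of a finite type whose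
   `Nat.card` does not exceed that of the target is a bijection (`Function.Surjective.bijective_of_nat_card_le`),
   so its kernel `(I + K)/I` vanishes: `K ≤ I` (`ker_le_span_singleton_of_card_le`).
2. `K ≤ I • K`: if `k = r x ∈ K` then `φ r · φ x = 0`, and `φ x` is a non-zero-divisor, so `r ∈ K`
   (`ker_le_span_singleton_smul_ker`).
3. `K` is finitely generated (`R` Noetherian) and `I ≤ Jac(R)`, so Nakayama
   (`Submodule.eq_bot_of_le_smul_of_le_jacobson_bot`) gives `K = ⊥`, i.e. `φ` is injective
   (`RingHom.injective_iff_ker_eq_bot`); it is surjective by hypothesis.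

Pure Mathlib commutative algebra; no named facts.
-/

set_option linter.dupNamespace false
set_option autoImplicit false

namespace Summit.Langlands.Langlands.Cruxes.ResiduallyYoshidaLifting.SectorKlingenSplit.Fibre

/-- Step 1.  If `φ : R ↠ S` is surjective, `R/(x)` is finite and `#R/(x) ≤ #S/(φ x)` (`Nat.card`), then
`ker φ ≤ (x)`: the induced surjection `R/(x) ↠ S/(φ x)` of finite sets is then a bijection, and every element of
`ker φ` lies in its kernel. [folklore] -/
theorem ker_le_span_singleton_of_card_le {R S : Type*} [CommRing R] [CommRing S] (φ : R →+* S) (x : R)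
    (hφ : Function.Surjective φ) [Finite (R ⧸ Ideal.span ({x} : Set R))]
    (hcard : Nat.card (R ⧸ Ideal.span ({x} : Set R)) ≤ Nat.card (S ⧸ Ideal.span ({φ x} : Set S))) :
    RingHom.ker φ ≤ Ideal.span {x} := by
  -- the induced surjection `R/(x) ↠ S/(φ x)`
  have hle : Ideal.span ({x} : Set R) ≤ (Ideal.span ({φ x} : Set S)).comap φ := by
    rw [Ideal.span_singleton_le_iff_mem, Ideal.mem_comap]
    exact Ideal.mem_span_singleton_self (φ x)
  have hψ : Function.Bijective (Ideal.quotientMap (Ideal.span ({φ x} : Set S)) φ hle) :=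
    (Ideal.quotientMap_surjective hφ).bijective_of_nat_card_le hcard
  intro r hr
  have h0 : Ideal.quotientMap (Ideal.span ({φ x} : Set S)) φ hle (Ideal.Quotient.mk _ r) =
      Ideal.quotientMap (Ideal.span ({φ x} : Set S)) φ hle 0 := by
    rw [Ideal.quotientMap_mk, RingHom.mem_ker.mp hr, map_zero, map_zero]
  exact Ideal.Quotient.eq_zero_iff_mem.mp (hψ.1 h0)

/-- Step 2.  If `ker φ ≤ (x)` and `φ x` is a non-zero-divisor of `S`, then `ker φ ≤ (x) • ker φ`: writing
`k = r x ∈ ker φ` gives `φ r · φ x = 0`, whence `φ r = 0`. [folklore] -/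
theorem ker_le_span_singleton_smul_ker {R S : Type*} [CommRing R] [CommRing S] (φ : R →+* S) (x : R)
    (hx : φ x ∈ nonZeroDivisors S) (hK : RingHom.ker φ ≤ Ideal.span {x}) :
    RingHom.ker φ ≤ Ideal.span {x} • RingHom.ker φ := by
  intro k hk
  obtain ⟨r, rfl⟩ := Ideal.mem_span_singleton'.mp (hK hk)
  have hr : r ∈ RingHom.ker φ := by
    rw [RingHom.mem_ker, map_mul] at hk
    exact RingHom.mem_ker.mpr ((mul_right_mem_nonZeroDivisors_eq_zero_iff hx).mp hk)
  rw [mul_comm, ← smul_eq_mul]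
  exact Submodule.smul_mem_smul (Ideal.mem_span_singleton_self x) hr

/-- **Registered sub-goal BK `stub_bergerKlosinCriterion`** (skeleton rev 13 of line `sector-klingen-split`): THE
BERGER–KLOSIN COMMUTATIVE-ALGEBRA `R = T` CRITERION (regular-element / Nakayama form).  Let `φ : R ↠ S` be a
surjection of commutative rings, `R` Noetherian, and `x ∈ R` in the Jacobson radical with `φ x` a non-zero-divisor
of `S`.  If `R/(x)` is finite and `#R/(x) ≤ #S/(φ x)`, then `φ` is an isomorphism: the surjection
`R/(x) ↠ S/(φ x) = R/((x) + ker φ)` of finite sets of the same size forces `ker φ ⊆ (x)`, then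
`ker φ = x · ker φ` (`φ x` regular), and Nakayama kills `ker φ`.  In Berger–Klosin, `x` generates the (principal)
reducibility ideal of the universal deformation ring and `#S/(φ x)` is a congruence-module lower bound — no
Taylor–Wiles primes are used.
[cite: BergerKlosin2012, §4 (the commutative algebra criterion; = arXiv:1103.5100 §7, Thm. 49 and Prop. 51)] -/
theorem stub_bergerKlosinCriterion :
    ∀ (R S : Type) [CommRing R] [CommRing S] [IsNoetherianRing R] (φ : R →+* S) (x : R),
      Function.Surjective φ → x ∈ (⊥ : Ideal R).jacobson → φ x ∈ nonZeroDivisors S →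
      Finite (R ⧸ Ideal.span ({x} : Set R)) →
      Nat.card (R ⧸ Ideal.span ({x} : Set R)) ≤ Nat.card (S ⧸ Ideal.span ({φ x} : Set S)) →
      Function.Bijective φ := by
  intro R S _ _ _ φ x hφ hxj hx hfin hcard
  refine ⟨?_, hφ⟩
  -- Step 1: `ker φ ≤ (x)` from the cardinality squeeze
  have hKI : RingHom.ker φ ≤ Ideal.span {x} := ker_le_span_singleton_of_card_le φ x hφ hcard
  -- Step 2: `ker φ ≤ (x) • ker φ` since `φ x` is regular
  have hKIK : RingHom.ker φ ≤ Ideal.span {x} • RingHom.ker φ :=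
    ker_le_span_singleton_smul_ker φ x hx hKI
  -- Step 3: Nakayama (`ker φ` is finitely generated, `(x) ≤ Jac R`)
  have hfg : (RingHom.ker φ).FG := IsNoetherian.noetherian _
  have hIj : Ideal.span ({x} : Set R) ≤ (⊥ : Ideal R).jacobson :=
    (Ideal.span_singleton_le_iff_mem _).mpr hxj
  have hK : RingHom.ker φ = ⊥ :=
    Submodule.eq_bot_of_le_smul_of_le_jacobson_bot (Ideal.span {x}) (RingHom.ker φ) hfg hKIK hIj
  exact (RingHom.injective_iff_ker_eq_bot φ).mpr hK

end Summit.Langlands.Langlands.Cruxes.ResiduallyYoshidaLifting.SectorKlingenSplit.Fibre
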